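import Literature.AlgebraicGeometry.Resolution.WeightedCentreZKernelClimb
import Literature.AlgebraicGeometry.Resolution.WeightedCentreLevelReduction
import HarnessLib

/-!
# Weighted centres — the restriction-tower step `ρ₁` is injective (REDUCTION of LF-MODEL §6.2, typed modulo THEOREM A⁺)

Instrument for engine 1's `W(f)` TOY MODEL (cell `pub-rosobs`, LF-MODEL-eng1-g45 §6.2 COROLLARY "restriction tower" and REDUCTION), NOT a resolution
theorem and NOT about the invariant of [AbramovichTemkinWlodarczyk2024].

The tower step: `ρ₁ : X ↦ X̄ = X mod (ε_Z)`, `Z = L₁` the bottom light class, maps the graded `k[σ]`-isotropies of `g` that FIX `ε_Z` (by THEOREM A⁺ — bottom-class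
rigidity, NOT typed — every isotropy of a `(P)`-menu does) to automorphisms of `k[ε][σ] ⧸ (ε_Z)`; it is a homomorphism (`OrderFiltration.reduce` on the stabiliser of the
ideal `(ε_Z)`, `ZKernel.restrictZ`), and ITS KERNEL IS `𝒢(N) ∩ Stab(g)` — trivial by THEOREM B (`ZKernel.eq_one`).  Hence `ρ₁` is injective on that group
(`ZKernel.restrictZ_injective`): the step "CONJECTURE B for the faces ⇒ ρ injective" of the REDUCTION, for one storey of the tower.

References: automorphisms of polynomial rings, ideals and quotients [Lang2002, Ch. I §3, Ch. II §1, Ch. IV §1]; the rest as in `WeightedCentreZKernelClimb`.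
-/

namespace Literature.AlgebraicGeometry.Resolution.WeightedBlowup.ZKernel

open Polynomial OrderFiltration LevelProjection EigenLiftLevels EigenLift TruncatedFlow

variable {k : Type*} [CommRing k] {ι : Type*}

/-! ## Fixing `ε_Z` stabilises the ideal `(ε_Z)` -/

/-- An automorphism fixing the slots `ε_Z` stabilises the ideal `(ε_Z)·k[ε][σ]` (bookkeeping). [cite: Lang2002, Ch. II §1] -/
theorem mem_idealStab_slotIdeal {Z : Set ι} {A : (MvPolynomial ι k)[X] ≃+* (MvPolynomial ι k)[X]} (hA : A ∈ fixSlots Z) :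
    A ∈ idealStab (slotIdeal Z) := by
  rw [mem_idealStab]
  refine le_antisymm (Ideal.map_le_iff_le_comap.mpr fun y hy => ?_) fun y hy => ?_
  · rw [Ideal.mem_comap, RingEquiv.coe_toRingHom]
    exact map_mem_slotIdeal (A := A) (fun z hz => hA z hz) hy
  · have hA' : ∀ z ∈ Z, A.symm (C (MvPolynomial.X z)) = C (MvPolynomial.X z) := fun z hz => by
      rw [RingEquiv.symm_apply_eq, hA z hz]
    have h := map_mem_slotIdeal (A := A.symm) hA' hy
    rw [← A.apply_symm_apply y]
    exact Ideal.mem_map_of_mem _ h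

/-! ## The isotropy group fixing `ε_Z` and the restriction `ρ₁` -/

/-- The graded `k[σ]`-isotropies of `g` in `𝔄_1` fixing the slots `ε_Z` (bottom class; THEOREM A⁺) and `ε_V` (weight `> p + 1`): the source of the tower step `ρ₁`
(LF-MODEL-eng1-g45 §6.2 COROLLARY; construction). [cite: Lang2002, Ch. I §3, Ch. IV §1; AbramovichTemkinWlodarczyk2024, §5.1 (p. 1575)] -/
noncomputable def isoFix (w : ι → ℚ) (Z V : Set ι) (g : MvPolynomial ι k) : Subgroup ((MvPolynomial ι k)[X] ≃+* (MvPolynomial ι k)[X]) :=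
  graded w (1 : ℚ) ⊓ baseFixing ⊓ level (X : (MvPolynomial ι k)[X]) 1 ⊓ fixSlots Z ⊓ fixSlots V ⊓
    MulAction.stabilizer ((MvPolynomial ι k)[X] ≃+* (MvPolynomial ι k)[X]) (C g : (MvPolynomial ι k)[X])

/-- `isoFix` stabilises `(ε_Z)` (bookkeeping). [cite: Lang2002, Ch. II §1] -/
theorem isoFix_le_idealStab (w : ι → ℚ) (Z V : Set ι) (g : MvPolynomial ι k) : isoFix w Z V g ≤ idealStab (slotIdeal Z) :=
  fun _ hA => mem_idealStab_slotIdeal hA.1.1.2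

/-- **The tower step `ρ₁ : X ↦ X mod (ε_Z)`** as a group homomorphism to `Aut (k[ε][σ] ⧸ (ε_Z))` (LF-MODEL-eng1-g45 §6.2 COROLLARY "`ρ₁ : Iso(N) → Iso(N ∖ L₁)` is a
well-defined homomorphism"; construction via `OrderFiltration.reduce`).  Instrument for engine 1's `W(f)` toy model, NOT a resolution theorem. [cite: Lang2002, Ch. II §1] -/
noncomputable def restrictZ (w : ι → ℚ) (Z V : Set ι) (g : MvPolynomial ι k) :
    isoFix w Z V g →* ((MvPolynomial ι k)[X] ⧸ slotIdeal Z ≃+* (MvPolynomial ι k)[X] ⧸ slotIdeal Z) :=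
  (reduce (slotIdeal Z)).comp (Subgroup.inclusion (isoFix_le_idealStab w Z V g))

/-- `ρ₁ X` on a class (bookkeeping). [cite: Lang2002, Ch. II §1] -/
theorem restrictZ_mk {w : ι → ℚ} {Z V : Set ι} {g : MvPolynomial ι k} (A : isoFix w Z V g) (y : (MvPolynomial ι k)[X]) :
    restrictZ w Z V g A (Ideal.Quotient.mk (slotIdeal Z) y) =
      Ideal.Quotient.mk (slotIdeal Z) ((A : (MvPolynomial ι k)[X] ≃+* (MvPolynomial ι k)[X]) y) :=
  reduce_mk _ y

/-- **The kernel of `ρ₁` lies in the `Z`-kernel**: `ρ₁ A = ρ₁ B ⇒ A⁻¹B ∈ zKernel Z` (LF-MODEL-eng1-g45 §6.2: "`ker ρ₁ = 𝒢(N)`", the inclusion needed; bookkeeping).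
[cite: Lang2002, Ch. I §3, Ch. II §1] -/
theorem inv_mul_mem_zKernel_of_restrictZ_eq {w : ι → ℚ} {Z V : Set ι} {g : MvPolynomial ι k} {A B : isoFix w Z V g}
    (h : restrictZ w Z V g A = restrictZ w Z V g B) :
    (A : (MvPolynomial ι k)[X] ≃+* (MvPolynomial ι k)[X])⁻¹ * B ∈ zKernel Z := by
  have hy : ∀ y, (A : (MvPolynomial ι k)[X] ≃+* (MvPolynomial ι k)[X]) y - (B : (MvPolynomial ι k)[X] ≃+* (MvPolynomial ι k)[X]) y ∈ slotIdeal Z :=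
    fun y => by
      have h' := reduce_eq_iff.mp h y
      rwa [Subgroup.coe_inclusion, Subgroup.coe_inclusion] at h'
  have hAZ : (A : (MvPolynomial ι k)[X] ≃+* (MvPolynomial ι k)[X]) ∈ fixSlots Z := A.2.1.1.2
  have hBZ : (B : (MvPolynomial ι k)[X] ≃+* (MvPolynomial ι k)[X]) ∈ fixSlots Z := B.2.1.1.2
  have hA' : ∀ z ∈ Z, (A : (MvPolynomial ι k)[X] ≃+* (MvPolynomial ι k)[X]).symm (C (MvPolynomial.X z)) = C (MvPolynomial.X z) :=
    fun z hz => by rw [RingEquiv.symm_apply_eq, hAZ z hz]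
  refine ⟨(fixSlots Z).mul_mem ((fixSlots Z).inv_mem hAZ) hBZ, fun y => ?_⟩
  have e : ((A : (MvPolynomial ι k)[X] ≃+* (MvPolynomial ι k)[X])⁻¹ * B) y - y =
      (A : (MvPolynomial ι k)[X] ≃+* (MvPolynomial ι k)[X]).symm
        ((B : (MvPolynomial ι k)[X] ≃+* (MvPolynomial ι k)[X]) y - (A : (MvPolynomial ι k)[X] ≃+* (MvPolynomial ι k)[X]) y) := by
    rw [RingAut.mul_apply, RingAut.inv_apply, map_sub, RingEquiv.symm_apply_apply]
  rw [e]
  refine map_mem_slotIdeal (A := (A : (MvPolynomial ι k)[X] ≃+* (MvPolynomial ι k)[X]).symm) hA' ?_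
  rw [← neg_sub]
  exact neg_mem (hy y)

/-! ## The tower step is injective (THEOREM B) -/

section Injective

variable {w : ι → ℚ} {Z : Set ι} {ζ : ℚ} (p : ℕ) [Fact p.Prime] [CharP k p] {u : ℕ → k} {g : MvPolynomial ι k}

/-- **`ρ₁` IS INJECTIVE** (LF-MODEL-eng1-g45 §6.2 REDUCTION, one storey: "if CONJECTURE B holds for the face then `ρ` is injective" — here with THEOREM B PROVED, `ZKernel.eq_one`): in the
setting — `char k = p`, `u_n n! = 1` (`n < p`), non-negative slot weights, bottom light class `Z` of weight in `[ζ, p)`, `ζ > 0`, `V ⊇` the slots of weight `> p + 1`, `V` of weight `> p + 1`,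
and `(N, g)` without tailed light flows (THEOREM 𝔉′) — two graded `k[σ]`-isotropies of `g` in `𝔄_1` fixing `ε_Z` and `ε_V` that agree modulo `(ε_Z)` are EQUAL: `A⁻¹B ∈ 𝒢(N) ∩ Stab(g) = {1}`.
(That every isotropy fixes `ε_Z` is THEOREM A⁺, not typed; with it, this is the injectivity of `Iso(N, g) → Iso(N ∖ L₁, g|)`.)  Instrument for engine 1's `W(f)` toy model, NOT a
resolution theorem. [cite: Lang2002, Ch. I §3, Ch. II §1, Ch. IV §1; Matsumura1987, §27 (pp. 207–209); AbramovichTemkinWlodarczyk2024, §5.1 (p. 1575)] -/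
theorem restrictZ_injective (hu : ∀ n < p, (Nat.factorial n : k) * u n = 1) (hw : ∀ i, 0 ≤ w i) (hZ : ∀ z ∈ Z, ζ ≤ w z) (hζ : 0 < ζ)
    (hZp : ∀ z ∈ Z, w z < p) {V : Set ι} (hVw : ∀ i, w i ≤ (p : ℚ) + 1 ∨ i ∈ V) (hwV : ∀ i ∈ V, (p : ℚ) + 1 < w i)
    (hN : TailedLightFlow.NoTailedLightFlow p u w g) : Function.Injective (restrictZ w Z V g) := fun A B h => by
  have hk := inv_mul_mem_zKernel_of_restrictZ_eq h
  have hC : (A : (MvPolynomial ι k)[X] ≃+* (MvPolynomial ι k)[X])⁻¹ * B ∈ isoFix w Z V g := (isoFix w Z V g).mul_mem ((isoFix w Z V g).inv_mem A.2) B.2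
  have h1 : (A : (MvPolynomial ι k)[X] ≃+* (MvPolynomial ι k)[X])⁻¹ * B = 1 :=
    eq_one p hu hw hZ hζ hZp hVw hwV hN hC.1.1.1.1.1 hC.1.1.1.1.2 hC.1.1.1.2 hk hC.1.2 (MulAction.mem_stabilizer_iff.mp hC.2)
  exact Subtype.ext (inv_mul_eq_one.mp h1)

end Injective

end Literature.AlgebraicGeometry.Resolution.WeightedBlowup.ZKernel
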